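import Literature.Probability.Percolation.AnchoredProfileVanishing
import Literature.Probability.Percolation.HalfSpaceProofs
import HarnessLib

/-!
# Discharges of named facts of `AnchoredIsoperimetricProfile.lean`

`Literature/Probability/Percolation/AnchoredIsoperimetricProfileHolds.lean` — proofs-only
sibling of `AnchoredIsoperimetricProfile.lean` (no definitions, no named facts). Each theorem
below closes a named fact `X : Prop` of that file as `X_holds : X` by composing an ACCEPTED
reduction theorem of the tree with the ACCEPTED unconditional `_holds` discharges of all of
its hypotheses; nothing is re-proved and no statement is changed. Recorded by the librarian
sweep g25 (2026-08-16, pass 5c: facts dischargeable in one line from the tree's own lemmas),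
so that the facts census, `#h21_route_deps` and the cone guardrail see these facts as
theorems.

Discharged here:

* `CerfDembin2020_thm12_holds` := `CerfDembin2020_thm12_of_BGN`
  `BarskyGrimmettNewman1991_holds` (`AnchoredProfileVanishing.lean`).

## References

* [CerfDembin2020] — see `lean/references.bib` and the docstring of the fact in `AnchoredIsoperimetricProfile.lean`.
-/

namespace Literature.Probability.Percolation

/-- **Discharge of the named fact `CerfDembin2020_thm12`** (`AnchoredIsoperimetricProfile.lean`):
Cerf–Dembin 2020, Theorem 1.2: the anchored isoperimetric profile vanishes at `p_c` along a
subsequence. "With probability one, we have `liminf_{n→∞} n φ̂_n(p_c) = 0`" (bond percolation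
on `ℤ^d`, `d ≥ 2`, at `p = p_c(d)`; proof: … — obtained as `CerfDembin2020_thm12_of_BGN`
applied to the tree's unconditional discharge `BarskyGrimmettNewman1991_holds` of its
hypothesis (reduction in `AnchoredProfileVanishing.lean`).
[cite: CerfDembin2020, Thm 1.2] -/
theorem CerfDembin2020_thm12_holds :
    CerfDembin2020_thm12 :=
  CerfDembin2020_thm12_of_BGN BarskyGrimmettNewman1991_holds

end Literature.Probability.Percolation
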